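import Summits.Ventures.GridStability.Models.DroopVoltageBox

/-!
# GridStability/Models/DroopFrequencyBand — the droop microgrid WITH Q–V dynamics: voltages in the certified box ⇒ every frequency deviation enters the droop band (FULL model, certificate-free, every `n`)

Cell `gridfusion` (LADDER-GRIDFUSION, apex line G3.b; seat gridfusion-model-3 (g7)). Composition of the two
structural theorems of this generation on the apex object N1 [cite: KunduEtAl2019, eqs. (4a)–(4c)] in the
bus-admittance form [cite: ShinZavala2020, (1a)–(1b), (8a)–(8c)] (typed `DroopMicrogrid.field`):
`Models/DroopVoltageBox.lean` (★ #87: the weighted voltage box `Π_i [0, λ w_i]` is positively invariant)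
and the Grönwall funnel of `Models/SwingFrequencyBound.lean` (★ #79, there for FROZEN voltages). Here the
voltages MOVE, but inside the certified box the active injection is uniformly bounded,
`|P_i(θ, V)| ≤ λ² w_i Σ_j (|G_ij| + |B_ij|) w_j =: P^max_i` (`abs_P_le_of_box`), so the frequency equation
`τ_Pi ω̇_i = −ω_i + λ^p_i (P_i^set − P_i(θ, V))` is a scalar funnel again.

WHAT IS CERTIFIED (kernel; no certificate, no kit). Under the hypotheses of
`DroopMicrogrid.voltage_wbox_invariant` (`τ_Qi > 0`, `λ^q_i ≥ 0`, `b_i > 0`, weighted susceptance dominance,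
`λ w_i > b_i`) plus `τ_Pi > 0`, `λ^p_i ≥ 0`: along EVERY solution of the FULL model (4a)–(4c) on `[0, T]`
whose voltages start in the box, for every node `i` and every `t ∈ [0, T]`,
`|ω_i(t)| ≤ λ^p_i (|P_i^set| + P^max_i) + |ω_i(0)| · e^{−t/τ_Pi}` (`abs_freq_le_of_box`) — the DROOP
FREQUENCY BAND of ★ #79 now for the model WITH voltage dynamics, angles arbitrary; and the band slab is
positively invariant (`abs_freq_le_of_box_of_le`).

THREE COLUMNS. CERTIFIED: the inequalities (std axioms). MODELLED: (4a)–(4c) in bus-admittance form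
(MV-6N/V0), no limiter, no inner loops; requires TRUE reduced self-susceptances. NOT an attractor or a
synchronisation statement (angles unrestricted), not voltage/frequency regulation quality; crude `P^max`.
VALIDATED: nothing.
-/

noncomputable section

open Real Set Filter Finset

namespace Summit.Ventures.GridStability.Models.DroopMicrogrid

variable {n : ℕ} (mg : DroopMicrogrid n)

/-- The box bound on the active injection: `P^max_i = λ² w_i Σ_j (|G_ij| + |B_ij|) w_j`. -/
def Pmax (w : Fin n → ℝ) (lam : ℝ) (i : Fin n) : ℝ :=
  lam ^ 2 * w i * ∑ j, (|mg.G i j| + |mg.B i j|) * w j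

/-- `|G_ij cos θ_ij + B_ij sin θ_ij| ≤ |G_ij| + |B_ij|`. -/
theorem abs_gP_le (θ : Fin n → ℝ) (i j : Fin n) :
    |mg.G i j * cos (θ i - θ j) + mg.B i j * sin (θ i - θ j)| ≤ |mg.G i j| + |mg.B i j| := by
  refine (abs_add_le _ _).trans ?_
  rw [abs_mul, abs_mul]
  exact add_le_add (mul_le_of_le_one_right (abs_nonneg _) (abs_cos_le_one _))
    (mul_le_of_le_one_right (abs_nonneg _) (abs_sin_le_one _))

/-- Inside the box `V_j ∈ [0, λ w_j]` the active injection is bounded: `|P_i(θ, V)| ≤ P^max_i`, all `θ`. -/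
theorem abs_P_le_of_box (θ V : Fin n → ℝ) {w : Fin n → ℝ} {lam : ℝ} (hlam : 0 ≤ lam)
    (hw : ∀ j, 0 ≤ w j) (hbox : ∀ j, 0 ≤ V j ∧ V j ≤ lam * w j) (i : Fin n) :
    |mg.P θ V i| ≤ mg.Pmax w lam i := by
  unfold P Pmax
  rw [mul_sum]
  refine (abs_sum_le_sum_abs _ _).trans (sum_le_sum fun j _ => ?_)
  rw [abs_mul, abs_mul, abs_of_nonneg (hbox i).1, abs_of_nonneg (hbox j).1]
  have h1 := mg.abs_gP_le θ i j
  have hVi := hbox i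
  have hVj := hbox j
  have hGB : 0 ≤ |mg.G i j| + |mg.B i j| := by positivity
  calc V i * V j * |mg.G i j * cos (θ i - θ j) + mg.B i j * sin (θ i - θ j)|
      ≤ (lam * w i) * (lam * w j) * (|mg.G i j| + |mg.B i j|) := by
        have := mul_le_mul hVi.2 hVj.2 hVj.1 (mul_nonneg hlam (hw i))
        exact mul_le_mul this h1 (abs_nonneg _)
          (mul_nonneg (mul_nonneg hlam (hw i)) (mul_nonneg hlam (hw j)))
    _ = lam ^ 2 * w i * ((|mg.G i j| + |mg.B i j|) * w j) := by ring

variable {mg}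

/-- The frequency component `ω_i` of a solution: derivative `dω` within the time set. -/
theorem hasDerivWithinAt_freq {γ : ℝ → State n} {s : Set ℝ} (h : mg.IsSolutionOn γ s) {t : ℝ}
    (ht : t ∈ s) (i : Fin n) :
    HasDerivWithinAt (fun τ => (γ τ).2.1 i) (mg.dω (γ t) i) s t := by
  have h2 : HasDerivWithinAt (fun τ => (γ τ).2.1) ((mg.field (γ t)).2.1) s t := by
    simpa using (h t ht).hasFDerivWithinAt.snd.fst.hasDerivWithinAt
  simpa [field] using (hasDerivWithinAt_pi.1 h2) i

/-- **Frequency funnel for the FULL droop+QV model (every `n`).** Under the voltage-box hypotheses of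
`voltage_wbox_invariant` and `τ_Pi > 0`, `λ^p_i ≥ 0`, with `K_i := λ^p_i (|P_i^set| + P^max_i)`: along
every solution of (4a)–(4c) on `[0, T]` with voltages starting in `Π_i [0, λ w_i]`, for every node and
every `t ∈ [0, T]`: `ω_i(t) − K_i ≤ (ω_i(0) − K_i) e^{−t/τ_Pi}` and `(ω_i(0) + K_i) e^{−t/τ_Pi} ≤ ω_i(t) + K_i`.
MODELLED: bus-admittance droop microgrid (MV-6N/V0); angles arbitrary. -/
theorem freq_funnel_of_box (hτQ : ∀ i, 0 < mg.τQ i) (hkQ : ∀ i, 0 ≤ mg.kQ i)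
    (hb : ∀ i, 0 < mg.Vset i + mg.kQ i * mg.Qset i)
    {w : Fin n → ℝ} (hw : ∀ i, 0 < w i)
    (hdom : ∀ i, ∑ j ∈ univ.erase i, (|mg.G i j| + |mg.B i j|) * w j ≤ -mg.B i i * w i)
    {lam : ℝ} (hlam : ∀ i, mg.Vset i + mg.kQ i * mg.Qset i < lam * w i)
    (hτP : ∀ i, 0 < mg.τP i) (hkP : ∀ i, 0 ≤ mg.kP i)
    {T : ℝ} {γ : ℝ → State n} (h : mg.IsSolutionOn γ (Icc 0 T))
    (h0 : ∀ i, 0 ≤ (γ 0).2.2 i ∧ (γ 0).2.2 i ≤ lam * w i) (i : Fin n) {t : ℝ} (ht : t ∈ Icc 0 T) :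
    (γ t).2.1 i - mg.kP i * (|mg.Pset i| + mg.Pmax w lam i)
        ≤ ((γ 0).2.1 i - mg.kP i * (|mg.Pset i| + mg.Pmax w lam i)) * exp (-(t / mg.τP i)) ∧
      ((γ 0).2.1 i + mg.kP i * (|mg.Pset i| + mg.Pmax w lam i)) * exp (-(t / mg.τP i))
        ≤ (γ t).2.1 i + mg.kP i * (|mg.Pset i| + mg.Pmax w lam i) := by
  have hbox := mg.voltage_wbox_invariant hτQ hkQ hb hw hdom hlam h h0
  have hlam0 : 0 ≤ lam := by
    by_contra hneg
    push Not at hneg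
    have := mul_neg_of_neg_of_pos hneg (hw i)
    linarith [hb i, hlam i]
  set K := mg.kP i * (|mg.Pset i| + mg.Pmax w lam i) with hK
  set c := (mg.τP i)⁻¹ with hc
  have hcpos : 0 < c := inv_pos.2 (hτP i)
  -- |λ^p (P^set − P)| ≤ K on the box
  have hdrive : ∀ τ ∈ Icc 0 T, |mg.kP i * (mg.Pset i - mg.P (γ τ).1 (γ τ).2.2 i)| ≤ K := by
    intro τ hτ
    have hP := mg.abs_P_le_of_box (γ τ).1 (γ τ).2.2 hlam0 (fun j => (hw j).le) (hbox τ hτ) i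
    rw [abs_mul, abs_of_nonneg (hkP i), hK]
    refine mul_le_mul_of_nonneg_left ?_ (hkP i)
    exact (abs_sub _ _).trans (add_le_add le_rfl hP)
  -- upper funnel: g = (ω − K) e^{c τ} is non-increasing on [0, T]
  have hωd := fun τ (hτ : τ ∈ Icc 0 T) => hasDerivWithinAt_freq h hτ i
  have hexpd : ∀ τ, HasDerivWithinAt (fun s => exp (c * s)) (exp (c * τ) * (c * 1)) (Icc 0 T) τ :=
    fun τ => ((hasDerivWithinAt_id τ _).const_mul c).exp
  have hup : ∀ τ ∈ Icc 0 T, (γ τ).2.1 i - K ≤ ((γ 0).2.1 i - K) * exp (-(c * τ)) := by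
    intro τ hτ
    set g : ℝ → ℝ := fun s => ((γ s).2.1 i - K) * exp (c * s) with hg
    have hder : ∀ s ∈ Icc 0 T, HasDerivWithinAt g
        ((mg.dω (γ s) i + c * ((γ s).2.1 i - K)) * exp (c * s)) (Icc 0 T) s := by
      intro s hs
      have h12 := ((hωd s hs).sub_const K).mul (hexpd s)
      refine h12.congr_deriv ?_
      ring
    have hanti : AntitoneOn g (Icc 0 T) := by
      refine antitoneOn_of_hasDerivWithinAt_nonpos (convex_Icc 0 T)
        (f' := fun s => (mg.dω (γ s) i + c * ((γ s).2.1 i - K)) * exp (c * s))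
        (fun s hs => (hder s hs).continuousWithinAt) (fun s hs => ?_) (fun s hs => ?_)
      · exact (hder s (interior_subset hs)).mono interior_subset
      · have hs' : s ∈ Icc 0 T := interior_subset hs
        have hd := hdrive s hs'
        have hnum : mg.dω (γ s) i + c * ((γ s).2.1 i - K) ≤ 0 := by
          have e : mg.dω (γ s) i + c * ((γ s).2.1 i - K)
              = c * (mg.kP i * (mg.Pset i - mg.P (γ s).1 (γ s).2.2 i) - K) := by
            simp only [dω, hc]; field_simp; ring
          rw [e]
          exact mul_nonpos_of_nonneg_of_nonpos hcpos.le (by linarith [(abs_le.mp hd).2])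
        exact mul_nonpos_of_nonpos_of_nonneg hnum (exp_pos _).le
    have hg0 := hanti ⟨le_rfl, hτ.1.trans hτ.2⟩ hτ hτ.1
    simp only [hg, mul_zero, exp_zero, mul_one] at hg0
    have hpos : 0 < exp (-(c * τ)) := exp_pos _
    have hmul := mul_le_mul_of_nonneg_right hg0 hpos.le
    have he : exp (c * τ) * exp (-(c * τ)) = 1 := by rw [← exp_add]; simp
    calc (γ τ).2.1 i - K = ((γ τ).2.1 i - K) * (exp (c * τ) * exp (-(c * τ))) := by rw [he, mul_one]
      _ = ((γ τ).2.1 i - K) * exp (c * τ) * exp (-(c * τ)) := by ring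
      _ ≤ ((γ 0).2.1 i - K) * exp (-(c * τ)) := hmul
  -- lower funnel: g = (ω + K) e^{c τ} is non-decreasing on [0, T]
  have hlo : ∀ τ ∈ Icc 0 T, ((γ 0).2.1 i + K) * exp (-(c * τ)) ≤ (γ τ).2.1 i + K := by
    intro τ hτ
    set g : ℝ → ℝ := fun s => ((γ s).2.1 i + K) * exp (c * s) with hg
    have hder : ∀ s ∈ Icc 0 T, HasDerivWithinAt g
        ((mg.dω (γ s) i + c * ((γ s).2.1 i + K)) * exp (c * s)) (Icc 0 T) s := by
      intro s hs
      have h12 := ((hωd s hs).add_const K).mul (hexpd s)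
      refine h12.congr_deriv ?_
      ring
    have hmono : MonotoneOn g (Icc 0 T) := by
      refine monotoneOn_of_hasDerivWithinAt_nonneg (convex_Icc 0 T)
        (f' := fun s => (mg.dω (γ s) i + c * ((γ s).2.1 i + K)) * exp (c * s))
        (fun s hs => (hder s hs).continuousWithinAt) (fun s hs => ?_) (fun s hs => ?_)
      · exact (hder s (interior_subset hs)).mono interior_subset
      · have hs' : s ∈ Icc 0 T := interior_subset hs
        have hd := hdrive s hs'
        have hnum : 0 ≤ mg.dω (γ s) i + c * ((γ s).2.1 i + K) := by
          have e : mg.dω (γ s) i + c * ((γ s).2.1 i + K)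
              = c * (mg.kP i * (mg.Pset i - mg.P (γ s).1 (γ s).2.2 i) + K) := by
            simp only [dω, hc]; field_simp; ring
          rw [e]
          exact mul_nonneg hcpos.le (by linarith [(abs_le.mp hd).1])
        exact mul_nonneg hnum (exp_pos _).le
    have hg0 := hmono ⟨le_rfl, hτ.1.trans hτ.2⟩ hτ hτ.1
    simp only [hg, mul_zero, exp_zero, mul_one] at hg0
    have hpos : 0 < exp (-(c * τ)) := exp_pos _
    have hmul := mul_le_mul_of_nonneg_right hg0 hpos.le
    have he : exp (c * τ) * exp (-(c * τ)) = 1 := by rw [← exp_add]; simp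
    calc ((γ 0).2.1 i + K) * exp (-(c * τ)) ≤ ((γ τ).2.1 i + K) * exp (c * τ) * exp (-(c * τ)) := hmul
      _ = ((γ τ).2.1 i + K) * (exp (c * τ) * exp (-(c * τ))) := by ring
      _ = (γ τ).2.1 i + K := by rw [he, mul_one]
  -- combine
  have hu := hup t ht
  have hl := hlo t ht
  have hct : -(c * t) = -(t / mg.τP i) := by rw [hc]; ring
  rw [hct] at hu hl
  exact ⟨hu, hl⟩

/-- **Droop frequency band for the FULL droop+QV model (every `n`).** Same hypotheses: for every node and
every `t ∈ [0, T]`, `|ω_i(t)| ≤ λ^p_i (|P_i^set| + P^max_i) + |ω_i(0)| e^{−t/τ_Pi}` — the droop band of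
★ #79, now with the voltages MOVING inside the certified box; angles arbitrary; a band, not an attractor. -/
theorem abs_freq_le_of_box (hτQ : ∀ i, 0 < mg.τQ i) (hkQ : ∀ i, 0 ≤ mg.kQ i)
    (hb : ∀ i, 0 < mg.Vset i + mg.kQ i * mg.Qset i)
    {w : Fin n → ℝ} (hw : ∀ i, 0 < w i)
    (hdom : ∀ i, ∑ j ∈ univ.erase i, (|mg.G i j| + |mg.B i j|) * w j ≤ -mg.B i i * w i)
    {lam : ℝ} (hlam : ∀ i, mg.Vset i + mg.kQ i * mg.Qset i < lam * w i)
    (hτP : ∀ i, 0 < mg.τP i) (hkP : ∀ i, 0 ≤ mg.kP i)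
    {T : ℝ} {γ : ℝ → State n} (h : mg.IsSolutionOn γ (Icc 0 T))
    (h0 : ∀ i, 0 ≤ (γ 0).2.2 i ∧ (γ 0).2.2 i ≤ lam * w i) (i : Fin n) {t : ℝ} (ht : t ∈ Icc 0 T) :
    |(γ t).2.1 i| ≤ mg.kP i * (|mg.Pset i| + mg.Pmax w lam i) + |(γ 0).2.1 i| * exp (-(t / mg.τP i)) := by
  obtain ⟨hu, hl⟩ := freq_funnel_of_box hτQ hkQ hb hw hdom hlam hτP hkP h h0 i ht
  have hK0 : 0 ≤ mg.kP i * (|mg.Pset i| + mg.Pmax w lam i) := by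
    have : 0 ≤ mg.Pmax w lam i := by
      unfold Pmax
      exact mul_nonneg (mul_nonneg (sq_nonneg _) (hw i).le)
        (sum_nonneg fun j _ => mul_nonneg (by positivity) (hw j).le)
    exact mul_nonneg (hkP i) (by positivity)
  have he : 0 < exp (-(t / mg.τP i)) := exp_pos _
  have h0a := le_abs_self ((γ 0).2.1 i)
  have h0b := neg_abs_le ((γ 0).2.1 i)
  rw [abs_le]
  constructor <;> nlinarith

/-- **The frequency slab is positively invariant (FULL model).** Under the same hypotheses, if moreover
`|ω_i(0)| ≤ λ^p_i (|P_i^set| + P^max_i)` then `|ω_i(t)| ≤ λ^p_i (|P_i^set| + P^max_i)` on `[0, T]`. -/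
theorem abs_freq_le_of_box_of_le (hτQ : ∀ i, 0 < mg.τQ i) (hkQ : ∀ i, 0 ≤ mg.kQ i)
    (hb : ∀ i, 0 < mg.Vset i + mg.kQ i * mg.Qset i)
    {w : Fin n → ℝ} (hw : ∀ i, 0 < w i)
    (hdom : ∀ i, ∑ j ∈ univ.erase i, (|mg.G i j| + |mg.B i j|) * w j ≤ -mg.B i i * w i)
    {lam : ℝ} (hlam : ∀ i, mg.Vset i + mg.kQ i * mg.Qset i < lam * w i)
    (hτP : ∀ i, 0 < mg.τP i) (hkP : ∀ i, 0 ≤ mg.kP i)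
    {T : ℝ} {γ : ℝ → State n} (h : mg.IsSolutionOn γ (Icc 0 T))
    (h0 : ∀ i, 0 ≤ (γ 0).2.2 i ∧ (γ 0).2.2 i ≤ lam * w i) (i : Fin n)
    (hω0 : |(γ 0).2.1 i| ≤ mg.kP i * (|mg.Pset i| + mg.Pmax w lam i)) {t : ℝ} (ht : t ∈ Icc 0 T) :
    |(γ t).2.1 i| ≤ mg.kP i * (|mg.Pset i| + mg.Pmax w lam i) := by
  obtain ⟨hu, hl⟩ := freq_funnel_of_box hτQ hkQ hb hw hdom hlam hτP hkP h h0 i ht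
  have he : 0 < exp (-(t / mg.τP i)) := exp_pos _
  have h0' := abs_le.mp hω0
  rw [abs_le]
  constructor <;> nlinarith

/-- **Frequency band from ANY nonnegative voltage start (FULL model).** With a set-point level `λ_b`
(`b_i ≤ λ_b w_i`) and ANY `Λ₀ > λ_b` dominating the initial voltages (`0 ≤ V_i(0) ≤ Λ₀ w_i`), the
`Λ₀`-box is itself an invariant box of `voltage_wbox_invariant`, so the funnel holds with `P^max` read at
level `Λ₀`: `|ω_i(t)| ≤ λ^p_i (|P_i^set| + P^max_i(Λ₀)) + |ω_i(0)| e^{−t/τ_Pi}` on `[0, T]`. Every physical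
(nonnegative-voltage) initial state lies in some `Λ₀`-box — a frequency band for EVERY motion of the model,
angles arbitrary (coarser the larger `Λ₀`). -/
theorem abs_freq_le_of_nonneg_start (hτQ : ∀ i, 0 < mg.τQ i) (hkQ : ∀ i, 0 ≤ mg.kQ i)
    (hb : ∀ i, 0 < mg.Vset i + mg.kQ i * mg.Qset i)
    {w : Fin n → ℝ} (hw : ∀ i, 0 < w i)
    (hdom : ∀ i, ∑ j ∈ univ.erase i, (|mg.G i j| + |mg.B i j|) * w j ≤ -mg.B i i * w i)
    {lamb : ℝ} (hlamb : ∀ i, mg.Vset i + mg.kQ i * mg.Qset i ≤ lamb * w i) {Λ₀ : ℝ} (hΛ : lamb < Λ₀)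
    (hτP : ∀ i, 0 < mg.τP i) (hkP : ∀ i, 0 ≤ mg.kP i)
    {T : ℝ} {γ : ℝ → State n} (h : mg.IsSolutionOn γ (Icc 0 T))
    (h0 : ∀ i, 0 ≤ (γ 0).2.2 i ∧ (γ 0).2.2 i ≤ Λ₀ * w i) (i : Fin n) {t : ℝ} (ht : t ∈ Icc 0 T) :
    |(γ t).2.1 i| ≤ mg.kP i * (|mg.Pset i| + mg.Pmax w Λ₀ i) + |(γ 0).2.1 i| * exp (-(t / mg.τP i)) := by
  have hlam : ∀ i, mg.Vset i + mg.kQ i * mg.Qset i < Λ₀ * w i := fun i =>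
    (hlamb i).trans_lt (mul_lt_mul_of_pos_right hΛ (hw i))
  exact abs_freq_le_of_box hτQ hkQ hb hw hdom hlam hτP hkP h h0 i ht

end Summit.Ventures.GridStability.Models.DroopMicrogrid

end
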